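import Summits.QuantumFields.YangMills.Theorems.BalabanUVNodesN19JointLawPriceAbsolutePolynomials

/-!
# YM-DAG node N19 (= NE7 proper) — COEFFICIENT MASS OF MULTIVARIATE POLYNOMIALS AND ITS PRICE IN THE UNIFORM MIXED-MOMENT CURRENCY
# (`mass(F+G) ≤ mass F + mass G`, `mass(FG) ≤ mass F·mass G`, `mass(Σ_k c_k B^k) ≤ Σ_k|c_k|·(mass B)^k`; `|∫F dP − ∫F dQ| ≤ mass F · r`)

Cell `pub-ymgap`, HUMAN RULING D-0062 (Track A) ∕ D-0149 (work-bound push), R141 (C) wider-strategy seat `pub-ymgap-dag-n19-e` (strategy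
s3 = ALTERNATIVE CURRENCY), generation g30, module 10 (lineage module 127).  Route `Summits/QuantumFields/YangMills/Theses/BalabanUVNodes.lean`,
cluster item K3⁸ «SpineGivenEndpointR13SepCoPHV» (stmt-QuantumFields-27366); filed `--supports` that item `--as helper` (it proves no registered
stub).  COUNT-NEUTRAL: [folklore]∕[bookkeeping] over Mathlib (`MvPolynomial.as_sum`, `monomial_mul`, `eval_eq'`) and module 62 `…N19JointLawBernstein`
BY NAME (`integrable_of_continuous_of_cube`, via module 115's imports); TOY laws under HYPOTHESES; no scheme object, no Theses import; NOT a discharge claim.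

PURPOSE.  The lineage's UNIFORM MIXED-MOMENT currency (modules 65, 107–116: all mixed moments of two laws on `[−1,1]^ι` are `r`-close) prices a
polynomial test `F` by its COEFFICIENT MASS `mass F = Σ_s|coeff_s F|`: `|∫F dP − ∫F dQ| ≤ mass F·r`.  So far the lineage priced only push-forwards
of ONE statistic (modules 108∕110∕115 expand `(Σ_i a_i x_i)^n` by hand).  The multiscale telescoping of PARTS 1–7 (degree model) multiplies `J ≍ log`
planted factors in DIFFERENT statistics `B_l`; to price it in the moment currency (PART 8, `…N19SingleModeMomentCurrency`) one needs the elementary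
algebra of the mass: §1 `sum_abs_coeff_eq_of_subset` · `mass_add_le` · `mass_sum_le` · `mass_monomial_le` · `mass_C_le` · ★ `mass_mul_le`
(`F·G = Σ_{a,b} monomial(a+b)(F_aG_b)` by `MvPolynomial.as_sum` ∕ `monomial_mul`) · `mass_pow_le` · ★ `mass_coeffSum_le` (`Σ_k C(c_k)B^k`: `≤ Σ_k|c_k|(mass B)^k`)
· `mass_sub_le` · §2 ★ `abs_integral_eval_sub_le_mass` (THE PRICE: `|∫F dP − ∫F dQ| ≤ mass F · r` for laws carried by the cube with `r`-close mixed
moments) · `abs_eval_le_mass` (`|F(x)| ≤ mass F` on the cube).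

HONEST FRAMING (binding).  Elementary and [folklore]; NO consumer in the DAG today (a tool for the seat's own currency map); nothing of Bałaban's
instantiated; NE7 NOT PRINTED, NOT proved; N19 NOT discharged; count-neutral.  One finite `T⁴` programme at fixed `ε`; nothing continuum ∕ `ℝ⁴` ∕ OS ∕
mass-gap ∕ Clay.  0 `def` ∕ 0 `sorry`.
-/

noncomputable section

open Real Finset MeasureTheory

namespace Summit.QuantumFields.YangMills.Theorems.BalabanUVNodesN19CoefficientMassPricing

open Summit.QuantumFields.YangMills.Theorems.BalabanUVNodesN19JointLawBernstein (integrable_of_continuous_of_cube)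

variable {ι : Type*}

/-! ## §1 The coefficient mass `Σ_s |coeff_s F|` [bookkeeping] -/

/-- The mass can be summed over any finite superset of the support. [bookkeeping] -/
theorem sum_abs_coeff_eq_of_subset (F : MvPolynomial ι ℝ) {S : Finset (ι →₀ ℕ)} (hS : F.support ⊆ S) :
    ∑ s ∈ S, |F.coeff s| = ∑ s ∈ F.support, |F.coeff s| := by
  symm
  refine Finset.sum_subset hS fun s _ hs => ?_
  rw [MvPolynomial.notMem_support_iff.1 hs, abs_zero]

/-- `mass(F + G) ≤ mass F + mass G`. [bookkeeping] -/
theorem mass_add_le (F G : MvPolynomial ι ℝ) :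
    ∑ s ∈ (F + G).support, |(F + G).coeff s| ≤ (∑ s ∈ F.support, |F.coeff s|) + ∑ s ∈ G.support, |G.coeff s| := by
  classical
  have hsub : (F + G).support ⊆ F.support ∪ G.support := MvPolynomial.support_add
  rw [← sum_abs_coeff_eq_of_subset (F + G) hsub, ← sum_abs_coeff_eq_of_subset F Finset.subset_union_left,
    ← sum_abs_coeff_eq_of_subset G Finset.subset_union_right, ← Finset.sum_add_distrib]
  refine Finset.sum_le_sum fun s _ => ?_
  rw [MvPolynomial.coeff_add]
  exact abs_add_le _ _

/-- `mass(Σ_{k∈K} F_k) ≤ Σ_{k∈K} mass F_k`. [bookkeeping] -/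
theorem mass_sum_le {κ : Type*} (K : Finset κ) (F : κ → MvPolynomial ι ℝ) :
    ∑ s ∈ (∑ k ∈ K, F k).support, |(∑ k ∈ K, F k).coeff s| ≤ ∑ k ∈ K, ∑ s ∈ (F k).support, |(F k).coeff s| := by
  classical
  induction K using Finset.induction_on with
  | empty => simp
  | insert a K ha ih =>
    rw [Finset.sum_insert ha, Finset.sum_insert ha]
    exact (mass_add_le _ _).trans (add_le_add le_rfl ih)

/-- `mass(monomial n c) ≤ |c|`. [bookkeeping] -/
theorem mass_monomial_le (n : ι →₀ ℕ) (c : ℝ) :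
    ∑ s ∈ (MvPolynomial.monomial n c : MvPolynomial ι ℝ).support, |(MvPolynomial.monomial n c : MvPolynomial ι ℝ).coeff s| ≤ |c| := by
  classical
  rw [← sum_abs_coeff_eq_of_subset _ MvPolynomial.support_monomial_subset, Finset.sum_singleton, MvPolynomial.coeff_monomial, if_pos rfl]

/-- `mass(C a) ≤ |a|`. [bookkeeping] -/
theorem mass_C_le (a : ℝ) :
    ∑ s ∈ (MvPolynomial.C a : MvPolynomial ι ℝ).support, |(MvPolynomial.C a : MvPolynomial ι ℝ).coeff s| ≤ |a| := by
  rw [← MvPolynomial.monomial_zero']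
  exact mass_monomial_le 0 a

/-- ★ `mass(F·G) ≤ mass F · mass G` (`F·G = Σ_{a∈supp F, b∈supp G} monomial(a+b)(F_a G_b)`). [folklore] -/
theorem mass_mul_le (F G : MvPolynomial ι ℝ) :
    ∑ s ∈ (F * G).support, |(F * G).coeff s| ≤ (∑ s ∈ F.support, |F.coeff s|) * ∑ s ∈ G.support, |G.coeff s| := by
  classical
  have hFG : F * G = ∑ a ∈ F.support, ∑ b ∈ G.support, MvPolynomial.monomial (a + b) (F.coeff a * G.coeff b) := by
    conv_lhs => rw [F.as_sum, G.as_sum]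
    rw [Finset.sum_mul_sum]
    refine Finset.sum_congr rfl fun a _ => Finset.sum_congr rfl fun b _ => ?_
    rw [MvPolynomial.monomial_mul]
  rw [hFG, Finset.sum_mul_sum]
  refine (mass_sum_le _ _).trans (Finset.sum_le_sum fun a _ => (mass_sum_le _ _).trans (Finset.sum_le_sum fun b _ => ?_))
  rw [← abs_mul]
  exact mass_monomial_le _ _

/-- `mass(F^k) ≤ (mass F)^k`. [bookkeeping] -/
theorem mass_pow_le (F : MvPolynomial ι ℝ) (k : ℕ) :
    ∑ s ∈ (F ^ k).support, |(F ^ k).coeff s| ≤ (∑ s ∈ F.support, |F.coeff s|) ^ k := by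
  induction k with
  | zero =>
    rw [pow_zero, pow_zero, ← MvPolynomial.C_1]
    exact (mass_C_le 1).trans (by rw [abs_one])
  | succ k ih =>
    rw [pow_succ, pow_succ]
    exact (mass_mul_le _ _).trans (mul_le_mul_of_nonneg_right ih (Finset.sum_nonneg fun s _ => abs_nonneg _))

/-- ★ **PLANTED COEFFICIENT SUMS**: `mass(Σ_{j<n} C(c_j)·B^j) ≤ Σ_{j<n}|c_j|·(mass B)^j`. [folklore] -/
theorem mass_coeffSum_le (c : ℕ → ℝ) (B : MvPolynomial ι ℝ) (n : ℕ) :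
    ∑ s ∈ (∑ j ∈ range n, MvPolynomial.C (c j) * B ^ j).support, |(∑ j ∈ range n, MvPolynomial.C (c j) * B ^ j).coeff s| ≤
      ∑ j ∈ range n, |c j| * (∑ s ∈ B.support, |B.coeff s|) ^ j := by
  refine (mass_sum_le _ _).trans (Finset.sum_le_sum fun j _ => ?_)
  refine (mass_mul_le _ _).trans ?_
  exact mul_le_mul (mass_C_le _) (mass_pow_le _ _) (Finset.sum_nonneg fun s _ => abs_nonneg _) (abs_nonneg _)

/-- `mass(−F) = mass F`. [bookkeeping] -/
theorem mass_neg (F : MvPolynomial ι ℝ) :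
    ∑ s ∈ (-F).support, |(-F).coeff s| = ∑ s ∈ F.support, |F.coeff s| := by
  rw [MvPolynomial.support_neg]
  exact Finset.sum_congr rfl fun s _ => by rw [MvPolynomial.coeff_neg, abs_neg]

/-- `mass(F − G) ≤ mass F + mass G`. [bookkeeping] -/
theorem mass_sub_le (F G : MvPolynomial ι ℝ) :
    ∑ s ∈ (F - G).support, |(F - G).coeff s| ≤ (∑ s ∈ F.support, |F.coeff s|) + ∑ s ∈ G.support, |G.coeff s| := by
  rw [sub_eq_add_neg]
  exact (mass_add_le F (-G)).trans (by rw [mass_neg])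

/-! ## §2 ★ The price of a polynomial test in the uniform mixed-moment currency [folklore] -/

/-- `|F(x)| ≤ mass F` on the cube `[−1,1]^ι`. [bookkeeping] -/
theorem abs_eval_le_mass [Fintype ι] (F : MvPolynomial ι ℝ) (x : ι → ℝ) (hx : ∀ i, x i ∈ Set.Icc (-1 : ℝ) 1) :
    |MvPolynomial.eval x F| ≤ ∑ s ∈ F.support, |F.coeff s| := by
  rw [MvPolynomial.eval_eq']
  refine (abs_sum_le_sum_abs _ _).trans (Finset.sum_le_sum fun s _ => ?_)
  rw [abs_mul]
  have hprod : |∏ i, x i ^ s i| ≤ 1 := by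
    rw [Finset.abs_prod]
    calc ∏ i, |x i ^ s i| ≤ ∏ _i : ι, (1 : ℝ) := Finset.prod_le_prod (fun i _ => abs_nonneg _) fun i _ => by
            rw [abs_pow]; exact pow_le_one₀ (abs_nonneg _) (abs_le.2 ⟨(hx i).1, (hx i).2⟩)
      _ = 1 := Finset.prod_const_one
  calc |F.coeff s| * |∏ i, x i ^ s i| ≤ |F.coeff s| * 1 := mul_le_mul_of_nonneg_left hprod (abs_nonneg _)
    _ = |F.coeff s| := mul_one _

/-- ★ **THE PRICE OF A POLYNOMIAL TEST.**  For probability laws `P, Q` on `ℝ^ι` carried by `[−1,1]^ι` whose mixed moments are `r`-close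
(`|∫∏x_i^{j_i}dP − ∫∏x_i^{j_i}dQ| ≤ r` for every `j`) and every `F : MvPolynomial ι ℝ`: `|∫F dP − ∫F dQ| ≤ mass F · r`. [folklore] -/
theorem abs_integral_eval_sub_le_mass [Fintype ι] {P Q : Measure (ι → ℝ)} [IsProbabilityMeasure P] [IsProbabilityMeasure Q]
    (hP : P (Set.pi Set.univ (fun _ : ι => Set.Icc (-1 : ℝ) 1))ᶜ = 0) (hQ : Q (Set.pi Set.univ (fun _ : ι => Set.Icc (-1 : ℝ) 1))ᶜ = 0)
    {r : ℝ} (hmom : ∀ j : ι → ℕ, |∫ x, ∏ i, x i ^ j i ∂P - ∫ x, ∏ i, x i ^ j i ∂Q| ≤ r) (F : MvPolynomial ι ℝ) :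
    |∫ x, MvPolynomial.eval x F ∂P - ∫ x, MvPolynomial.eval x F ∂Q| ≤ (∑ s ∈ F.support, |F.coeff s|) * r := by
  classical
  have hcont : ∀ s : ι →₀ ℕ, Continuous fun x : ι → ℝ => F.coeff s * ∏ i, x i ^ s i := fun s =>
    continuous_const.mul (continuous_finsetProd _ fun i _ => (continuous_apply i).pow _)
  have hexp : ∀ (μ : Measure (ι → ℝ)) [IsProbabilityMeasure μ], μ (Set.pi Set.univ (fun _ : ι => Set.Icc (-1 : ℝ) 1))ᶜ = 0 →
      ∫ x, MvPolynomial.eval x F ∂μ = ∑ s ∈ F.support, F.coeff s * ∫ x, ∏ i, x i ^ s i ∂μ := by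
    intro μ _ hμ
    have hfun : (fun x : ι → ℝ => MvPolynomial.eval x F) = fun x => ∑ s ∈ F.support, F.coeff s * ∏ i, x i ^ s i := by
      funext x; exact MvPolynomial.eval_eq' x F
    rw [hfun, integral_finsetSum _ (fun s _ => integrable_of_continuous_of_cube hμ (hcont s))]
    exact Finset.sum_congr rfl fun s _ => integral_const_mul _ _
  rw [hexp P hP, hexp Q hQ, ← Finset.sum_sub_distrib, Finset.sum_mul]
  refine (abs_sum_le_sum_abs _ _).trans (Finset.sum_le_sum fun s _ => ?_)
  rw [← mul_sub, abs_mul]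
  exact mul_le_mul_of_nonneg_left (hmom _) (abs_nonneg _)

end Summit.QuantumFields.YangMills.Theorems.BalabanUVNodesN19CoefficientMassPricing

end
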